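import Summits.ValiantsHypothesis.ValiantsHypothesis.Theses.FreeSubtorus
import Summits.ValiantsHypothesis.ValiantsHypothesis.Theorems.RigidMinimalRepsTorusBound
import Literature.Computability.AlgebraicComplexity.GrenetEquivariant
import Literature.Computability.AlgebraicComplexity.PermanentVsDeterminantProofs

/-!
# `FreeSubtorus.OrbitDimensionBound` (stmt-ValiantsHypothesis-16133): the `r = 0` strengthening is Grenet-optimality

Negative knowledge for the crux (standing disprover, cycle 1, 2026-08-17).  `OrbitDimensionBound`
allows `r ≤ n/2` admissible relations.  Its strengthening with `r = 0` — every size `m ≥ dc(per_n)`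
carries a representation equivariant (exact lifts) under the FULL two-sided torus — is EQUIVALENT
to Grenet-optimality `dc(per_n) = 2ⁿ − 1` for all `n ≥ 3` (`orbitDimensionBound_r0_iff_grenetOptimal`):
(→) an optimal representation made `T'`-equivariant has size `≥ 2ⁿ − 1` by the PROVED sibling-route
item `RigidMinimalReps.TorusBound` (stmt-5114, `torusBound_proof`), and `≤ 2ⁿ − 1` is Grenet;
(←) Grenet's representation is `T'`-equivariant with exact lifts (`Grenet.hasEquivariantDetRepr_perPoly_twoSidedTorus`)
and padding `B ↦ B ⊕ 1` preserves exact lifts (`isEquivariantDetRepr_pad`).  In particular the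
`r = 0` version already decides `dc(per₄) = 15` (open; tree `9 ≤ dc(per₄) ≤ 15`), so it is not a
cheaper target than the crux, and not refutable today either.  Inline statements, no definitions.
-/

noncomputable section

namespace Summit.ValiantsHypothesis.Theorems.OrbitDimensionBoundNegative

open MvPolynomial Matrix
open Literature.Computability.AlgebraicComplexity

universe u

/-- **Padding preserves equivariance with exact lifts**: if `B` (size `m`) is a `Γ`-equivariant
affine determinantal representation of `f`, so is `B ⊕ 1_c` reindexed to `Fin (m + c)` (lift
`(g ⊕ 1, h ⊕ 1)`). [cite: LandsbergRessayre2017, Def. 1.3] [cite: MignonRessayre2004, §1] -/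
theorem isEquivariantDetRepr_pad {k : Type u} [CommRing k] {σ : Type u} [Fintype σ] [DecidableEq σ]
    {Γ : Subgroup (GL σ k)} {f : MvPolynomial σ k} {m : ℕ}
    {B : Matrix (Fin m) (Fin m) (MvPolynomial σ k)} (hB : IsEquivariantDetRepr Γ f B) (c : ℕ) :
    IsEquivariantDetRepr Γ f (Matrix.reindex finSumFinEquiv finSumFinEquiv
      (Matrix.fromBlocks B 0 0 (1 : Matrix (Fin c) (Fin c) (MvPolynomial σ k)))) := by
  -- the padding as an operation, its multiplicativity and compatibility with entrywise maps
  let P : ∀ {R : Type u} [Zero R] [One R], Matrix (Fin m) (Fin m) R → Matrix (Fin (m + c)) (Fin (m + c)) R :=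
    fun X => Matrix.reindex finSumFinEquiv finSumFinEquiv (Matrix.fromBlocks X 0 0 1)
  have hPmul : ∀ {R : Type u} [Semiring R] (X Y : Matrix (Fin m) (Fin m) R), P X * P Y = P (X * Y) := by
    intro R _ X Y
    simp only [P, Matrix.reindex_apply, Matrix.submatrix_mul_equiv, Matrix.fromBlocks_multiply]
    simp
  have hPmap : ∀ {R S : Type u} [Semiring R] [Semiring S] (X : Matrix (Fin m) (Fin m) R) (φ : R →+* S),
      (P X).map φ = P (X.map φ) := by
    intro R S _ _ X φ
    simp only [P, Matrix.reindex_apply]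
    rw [← Matrix.submatrix_map, Matrix.fromBlocks_map, Matrix.map_zero _ (map_zero φ),
      Matrix.map_zero _ (map_zero φ), Matrix.map_one _ (map_zero φ) (map_one φ)]
  have hPone : ∀ {R : Type u} [Semiring R], P (1 : Matrix (Fin m) (Fin m) R) = 1 := by
    intro R _
    simp only [P, Matrix.reindex_apply, Matrix.fromBlocks_one, Matrix.submatrix_one_equiv]
  -- padded units
  let U : GL (Fin m) k → GL (Fin (m + c)) k := fun g =>
    ⟨P (g : Matrix (Fin m) (Fin m) k), P ((g⁻¹ : GL (Fin m) k) : Matrix (Fin m) (Fin m) k),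
      by rw [hPmul, ← Units.val_mul, mul_inv_cancel, Units.val_one, hPone],
      by rw [hPmul, ← Units.val_mul, inv_mul_cancel, Units.val_one, hPone]⟩
  refine ⟨⟨fun i j => ?_, ?_⟩, fun γ hγ => ?_⟩
  · rw [Matrix.reindex_apply, Matrix.submatrix_apply]
    generalize finSumFinEquiv.symm i = a
    generalize finSumFinEquiv.symm j = b
    rcases a with a | a <;> rcases b with b | b
    · simpa using hB.1.1 a b
    · simp
    · simp
    · simp only [Matrix.fromBlocks_apply₂₂, Matrix.one_apply]
      split_ifs <;> simp
  · rw [Matrix.det_reindex_self, Matrix.det_fromBlocks_zero₂₁, Matrix.det_one, mul_one, hB.1.2]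
  · obtain ⟨g, h, hgh⟩ := hB.2 γ hγ
    refine ⟨U g, U h, ?_⟩
    have hL : Matrix.linSubstEntries γ (P B) = P (Matrix.linSubstEntries γ B) := by
      simp only [Matrix.linSubstEntries]
      exact hPmap B (linSubst σ k (γ : Matrix σ σ k)).toRingHom
    have hg : ((U g : GL (Fin (m + c)) k) : Matrix (Fin (m + c)) (Fin (m + c)) k).map
        (C : k →+* MvPolynomial σ k) = P ((g : Matrix (Fin m) (Fin m) k).map (C : k →+* MvPolynomial σ k)) :=
      hPmap (g : Matrix (Fin m) (Fin m) k) (C : k →+* MvPolynomial σ k)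
    have hUinv : ((U h)⁻¹ : GL (Fin (m + c)) k) = U h⁻¹ := by
      rw [inv_eq_iff_mul_eq_one]
      ext1
      rw [Units.val_mul, Units.val_one]
      show P (h : Matrix (Fin m) (Fin m) k) * P ((h⁻¹ : GL (Fin m) k) : Matrix (Fin m) (Fin m) k) = 1
      rw [hPmul, ← Units.val_mul, mul_inv_cancel, Units.val_one, hPone]
    have hh : (((U h)⁻¹ : GL (Fin (m + c)) k) : Matrix (Fin (m + c)) (Fin (m + c)) k).map
        (C : k →+* MvPolynomial σ k) =
        P (((h⁻¹ : GL (Fin m) k) : Matrix (Fin m) (Fin m) k).map (C : k →+* MvPolynomial σ k)) := by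
      rw [hUinv]
      exact hPmap ((h⁻¹ : GL (Fin m) k) : Matrix (Fin m) (Fin m) k) (C : k →+* MvPolynomial σ k)
    show Matrix.linSubstEntries γ (P B) = _
    rw [hL, hg, hh, hPmul, hPmul, hgh]

/-- **The `r = 0` strengthening of `OrbitDimensionBound` is equivalent to Grenet-optimality for all
`n ≥ 3`.**  Left: for `n ≥ 3`, every size carrying a representation of `per_n` carries one that is
equivariant (exact lifts) under the crux's subtorus with NO relations (`r = 0`, the full two-sided
torus in generator form).  Right: `dc(per_n) = 2ⁿ − 1` for all `n ≥ 3`. [folklore] -/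
theorem orbitDimensionBound_r0_iff_grenetOptimal :
    (∀ n : ℕ, 3 ≤ n → ∀ (m : ℕ) (A : Matrix (Fin m) (Fin m) (MvPolynomial (Fin n × Fin n) ℂ)),
      IsAffineDetRepr (perPoly (Fin n) ℂ) A →
      ∃ B : Matrix (Fin m) (Fin m) (MvPolynomial (Fin n × Fin n) ℂ),
        IsEquivariantDetRepr (Subgroup.closure {γ : Matrix.GeneralLinearGroup (Fin n × Fin n) ℂ |
          ∃ d e : Fin n → ℂˣ, (∀ i : Fin 0, (∏ k, (d k) ^ ((Fin.elim0 i : (Fin n ⊕ Fin n) → ℤ) (Sum.inl k))) *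
              (∏ l, (e l) ^ ((Fin.elim0 i : (Fin n ⊕ Fin n) → ℤ) (Sum.inr l))) = 1) ∧
            (γ : Matrix (Fin n × Fin n) (Fin n × Fin n) ℂ) =
              Matrix.diagonal (fun p => (d p.1 : ℂ) * (e p.2 : ℂ))}) (perPoly (Fin n) ℂ) B) ↔
    ∀ n : ℕ, 3 ≤ n → determinantalComplexity (perPoly (Fin n) ℂ) = 2 ^ n - 1 := by
  -- the crux's `r = 0` torus versus the stmt-5114 torus and Grenet's torus
  have hle₁ : ∀ n : ℕ, Subgroup.closure {γ : Matrix.GeneralLinearGroup (Fin n × Fin n) ℂ | ∃ d e : Fin n → ℂ,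
      (∀ i, d i ≠ 0) ∧ (∀ j, e j ≠ 0) ∧ (γ : Matrix (Fin n × Fin n) (Fin n × Fin n) ℂ) =
        Matrix.diagonal (fun p => d p.1 * e p.2)} ≤
      Subgroup.closure {γ : Matrix.GeneralLinearGroup (Fin n × Fin n) ℂ |
          ∃ d e : Fin n → ℂˣ, (∀ i : Fin 0, (∏ k, (d k) ^ ((Fin.elim0 i : (Fin n ⊕ Fin n) → ℤ) (Sum.inl k))) *
              (∏ l, (e l) ^ ((Fin.elim0 i : (Fin n ⊕ Fin n) → ℤ) (Sum.inr l))) = 1) ∧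
            (γ : Matrix (Fin n × Fin n) (Fin n × Fin n) ℂ) =
              Matrix.diagonal (fun p => (d p.1 : ℂ) * (e p.2 : ℂ))} := by
    intro n
    refine (Subgroup.closure_le _).2 ?_
    rintro γ ⟨d, e, hd, he, hγ⟩
    refine Subgroup.subset_closure ⟨fun i => Units.mk0 (d i) (hd i), fun j => Units.mk0 (e j) (he j),
      fun i => i.elim0, ?_⟩
    rw [hγ]
    rfl
  have hle₂ : ∀ n : ℕ, Subgroup.closure {γ : Matrix.GeneralLinearGroup (Fin n × Fin n) ℂ |
          ∃ d e : Fin n → ℂˣ, (∀ i : Fin 0, (∏ k, (d k) ^ ((Fin.elim0 i : (Fin n ⊕ Fin n) → ℤ) (Sum.inl k))) *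
              (∏ l, (e l) ^ ((Fin.elim0 i : (Fin n ⊕ Fin n) → ℤ) (Sum.inr l))) = 1) ∧
            (γ : Matrix (Fin n × Fin n) (Fin n × Fin n) ℂ) =
              Matrix.diagonal (fun p => (d p.1 : ℂ) * (e p.2 : ℂ))} ≤
      Subgroup.closure {γ : GL (Fin n × Fin n) ℂ | ∃ d e : Fin n → ℂ,
        (γ : Matrix (Fin n × Fin n) (Fin n × Fin n) ℂ) = Matrix.diagonal (fun p => d p.1 * e p.2)} := by
    intro n
    refine (Subgroup.closure_le _).2 ?_
    rintro γ ⟨d, e, -, hγ⟩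
    exact Subgroup.subset_closure ⟨fun i => (d i : ℂ), fun j => (e j : ℂ), hγ⟩
  refine ⟨fun h n hn => le_antisymm (determinantalComplexity_perPoly_le_holds ℂ n (by omega)) ?_,
    fun h n hn m A hA => ?_⟩
  · obtain ⟨A, hA⟩ := hasDetRepr_determinantalComplexity_holds (perPoly (Fin n) ℂ)
    obtain ⟨B, hB⟩ := h n hn _ A hA
    exact Summit.ValiantsHypothesis.ValiantsHypothesis.Theorems.RigidMinimalRepsTorusBound.torusBound_proof
      n hn _ B (hB.anti (hle₁ n))
  · have hle : determinantalComplexity (perPoly (Fin n) ℂ) ≤ m :=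
      determinantalComplexity_le_of_hasDetRepr ⟨A, hA⟩
    rw [h n hn] at hle
    obtain ⟨c, hc⟩ := Nat.exists_eq_add_of_le hle
    obtain ⟨B₀, hB₀⟩ := Grenet.hasEquivariantDetRepr_perPoly_twoSidedTorus ℂ (n := n) (by omega)
    rw [hc]
    exact ⟨_, isEquivariantDetRepr_pad (hB₀.anti (hle₂ n)) c⟩

/-- Sanity: the `r = 0` strengthening implies the crux BY NAME (the empty family of relations is
admissible and `0 ≤ n/2`). [folklore] -/
theorem orbitDimensionBound_of_r0
    (h : ∀ n : ℕ, 3 ≤ n → ∀ (m : ℕ) (A : Matrix (Fin m) (Fin m) (MvPolynomial (Fin n × Fin n) ℂ)),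
      IsAffineDetRepr (perPoly (Fin n) ℂ) A →
      ∃ B : Matrix (Fin m) (Fin m) (MvPolynomial (Fin n × Fin n) ℂ),
        IsEquivariantDetRepr (Subgroup.closure {γ : Matrix.GeneralLinearGroup (Fin n × Fin n) ℂ |
          ∃ d e : Fin n → ℂˣ, (∀ i : Fin 0, (∏ k, (d k) ^ ((Fin.elim0 i : (Fin n ⊕ Fin n) → ℤ) (Sum.inl k))) *
              (∏ l, (e l) ^ ((Fin.elim0 i : (Fin n ⊕ Fin n) → ℤ) (Sum.inr l))) = 1) ∧
            (γ : Matrix (Fin n × Fin n) (Fin n × Fin n) ℂ) =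
              Matrix.diagonal (fun p => (d p.1 : ℂ) * (e p.2 : ℂ))}) (perPoly (Fin n) ℂ) B) :
    Summit.ValiantsHypothesis.ValiantsHypothesis.Theses.FreeSubtorus.OrbitDimensionBound := by
  intro n hn m A hA
  obtain ⟨B, hB⟩ := h n hn m A hA
  exact ⟨B, 0, Fin.elim0, Nat.zero_le _, fun i => i.elim0, hB⟩

/-- Hence: if Grenet is NOT optimal for some `n ≥ 3` (a representation of `per_n` of size
`≤ 2ⁿ − 2` exists), the `r = 0` strengthening is false — the relations `Λ` (`r ≥ 1`) become
load-bearing for the crux. [folklore] -/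
theorem not_r0_of_subGrenet
    (hsub : ∃ n : ℕ, 3 ≤ n ∧ determinantalComplexity (perPoly (Fin n) ℂ) < 2 ^ n - 1) :
    ¬ ∀ n : ℕ, 3 ≤ n → ∀ (m : ℕ) (A : Matrix (Fin m) (Fin m) (MvPolynomial (Fin n × Fin n) ℂ)),
      IsAffineDetRepr (perPoly (Fin n) ℂ) A →
      ∃ B : Matrix (Fin m) (Fin m) (MvPolynomial (Fin n × Fin n) ℂ),
        IsEquivariantDetRepr (Subgroup.closure {γ : Matrix.GeneralLinearGroup (Fin n × Fin n) ℂ |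
          ∃ d e : Fin n → ℂˣ, (∀ i : Fin 0, (∏ k, (d k) ^ ((Fin.elim0 i : (Fin n ⊕ Fin n) → ℤ) (Sum.inl k))) *
              (∏ l, (e l) ^ ((Fin.elim0 i : (Fin n ⊕ Fin n) → ℤ) (Sum.inr l))) = 1) ∧
            (γ : Matrix (Fin n × Fin n) (Fin n × Fin n) ℂ) =
              Matrix.diagonal (fun p => (d p.1 : ℂ) * (e p.2 : ℂ))}) (perPoly (Fin n) ℂ) B := by
  intro h
  obtain ⟨n, hn, hlt⟩ := hsub
  have := (orbitDimensionBound_r0_iff_grenetOptimal.1 h) n hn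
  omega

end Summit.ValiantsHypothesis.Theorems.OrbitDimensionBoundNegative

end
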